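import Summits.CriticalPhenomena.SAWScalingLimit.Theses.SAWDefectDecoherence
import Summits.CriticalPhenomena.SAWScalingLimit.Theses.SAWPhaseRetrieval
import Summits.CriticalPhenomena.SAWScalingLimit.Theses.SAWWindingAlias
import Summits.CriticalPhenomena.SAWScalingLimit.Theses.SAWDevelopingMap
import Summits.CriticalPhenomena.SAWScalingLimit.Theses.SAWCompassLattice
import Summits.CriticalPhenomena.SAWScalingLimit.Theses.SAWResidueField
import Literature.Probability.RandomPlanarGeometry.SLEUniquenessInLaw
import Literature.Probability.RandomPlanarGeometry.SelfAvoidingWalkProofs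
import Summits.CriticalPhenomena.SAWScalingLimit.Theorems.HexConjecture.Negative.NonVacuity

/-!
# `HexTransfer` (crux stmt-CriticalPhenomena-14221) — what a refutation costs; rigidity under DCS Conjecture 1

Negative-side lemmas (crux disprover, `--supports stmt-CriticalPhenomena-14221`) for the shared tail crux

  `HexTransfer := (Duminil-Copin–Smirnov 2012 Conjecture 1 on the hexagonal lattice, written out) → SAWScalingLimit`

(identical bodies in `Theses.SAWDefectDecoherence / .SAWPhaseRetrieval / .SAWWindingAlias / .SAWDevelopingMap`;
the antecedent is `Literature…SAW.HexSAWScalingLimit` = `Theses.….HexConjecture`, crux stmt-0808).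
No conclusion below asserts a Theses decl positively.

* §1 ONE STATEMENT: the four route copies agree, and `HexTransfer ↔ (HexSAWScalingLimit → SAWScalingLimit)`
  (`Iff.rfl`).
* §2 REFUTATION COST: `¬ HexTransfer ↔ HexSAWScalingLimit ∧ ¬ SAWScalingLimit` — a refutation must PROVE
  DCS Conjecture 1 (open) and DISPROVE the audited δℤ² sub-problem statement; generally, no implication INTO
  the summit conjunct is refutable short of refuting the summit conjunct (`not_target_of_not_imp_target`),
  and under the antecedent the crux IS the summit conjunct (`hexTransfer_iff_target_of_antecedent`).
  A refuter also inherits the SLE existence debt: under `¬ HexTransfer` a chordal SLE(8/3) random curve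
  exists in every Dobrushin domain carrying a hexagonal endpoint approximation, unconditionally in the
  unit disc (`exists_isSLECurve_unitDisc_of_not_hexTransfer`, via the sibling crux's
  `HexConjecture.NonVacuity`).
* §3 RIGIDITY UNDER THE ANTECEDENT: the route docstrings file the implicational form as "weaker than the
  asymptotic equality of laws LatticeUniversality (stmt-0807)"; that is true only in the vacuous regime.
  If DCS Conjecture 1 holds, `HexTransfer` FORCES `LatticeUniversality` for EVERY pairing of a δℤ² and a
  hexagonal endpoint approximation (uniqueness in law of chordal SLE_κ in a Dobrushin domain,
  `IsSLECurve.map_eq_holds`, proved in the tree): stated negatively,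
  `not_hexTransfer_of_not_latticeUniversality : HexSAWScalingLimit → ¬ LatticeUniversality → ¬ HexTransfer`.
  So wherever the crux has content it is exactly as strong as lattice universality of the chordal law;
  "it may use existence and conformal invariance of the hexagonal limit" buys nothing at the level of
  statements.
* §4 LINE `Sketch` (lead prover-line-stmt-CriticalPhenomena-14221-0): the same accounting for the open stub
  `stub_thetaTransport : HexConjecture → YBSquareSLE` — `¬ stub ↔ HexSAWScalingLimit ∧ ¬ YBSquareSLE`
  (refuting it refutes crux stmt-6967 AND proves DCS Conjecture 1), and under the antecedent the stub is
  `YBSquareSLE` itself.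
* §5 NO MESH-WISE IDENTIFICATION OF THE TWO CRITICAL WEIGHTS: `x_c(ℤ²) ≤ 1/2 < 1/√(2+√2) = x_c(ℍ)`
  (`criticalFugacity_lt_hexCriticalFugacity`, from the proved `2 ≤ μ(ℤ²)`): the Gibbs weights
  `x_c(ℤ²)^{|γ|}` and `x_c(ℍ)^{ℓ(γ)}` are powers of different numbers, so no transfer is an identity of
  finite-volume weights on a common family of walks — every hexagonal ⇒ square transfer is asymptotic
  (folklore; recorded against recurring "re-embed the walks with the same weight" ideas).
-/

noncomputable section

namespace Summit.CriticalPhenomena.SAWScalingLimit.Cruxes.HexTransfer.Negative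

open MeasureTheory Filter Topology
open Literature.Probability.LatticeModels Literature.Probability.RandomPlanarGeometry
open Literature.Probability.RandomPlanarGeometry.SAW
open Summit.CriticalPhenomena.SAWScalingLimit.Theses
open scoped NNReal ENNReal BoundedContinuousFunction

/-! ## §1 One statement -/

/-- The crux is `DCS Conjecture 1 (hexagonal, as formalised) → the δℤ² sub-problem statement`. [folklore] -/
theorem hexTransfer_iff :
    SAWDefectDecoherence.HexTransfer ↔ (HexSAWScalingLimit → _root_.SAWScalingLimit) := Iff.rfl

/-- Clone in `SAWPhaseRetrieval` (the decl the item stmt-14221 is registered under). [folklore] -/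
theorem hexTransfer_iff_phaseRetrieval :
    SAWDefectDecoherence.HexTransfer ↔ SAWPhaseRetrieval.HexTransfer := Iff.rfl

/-- Clone in `SAWWindingAlias`. [folklore] -/
theorem hexTransfer_iff_windingAlias :
    SAWDefectDecoherence.HexTransfer ↔ SAWWindingAlias.HexTransfer := Iff.rfl

/-- Clone in `SAWDevelopingMap` (the decl the line `Sketch` closes). [folklore] -/
theorem hexTransfer_iff_developingMap :
    SAWDefectDecoherence.HexTransfer ↔ SAWDevelopingMap.HexTransfer := Iff.rfl

/-- The antecedent is the sibling crux `HexConjecture` (stmt-0808; its live copy is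
`Theses.SAWDevelopingMap.HexConjecture`) verbatim. [folklore] -/
theorem hexTransfer_iff_hexConjecture_imp :
    SAWDefectDecoherence.HexTransfer ↔ (SAWDevelopingMap.HexConjecture → _root_.SAWScalingLimit) :=
  Iff.rfl

/-! ## §2 Refutation cost -/

/-- **What `¬ HexTransfer` is**: DCS Conjecture 1 on the hexagonal lattice holds AND the δℤ² sub-problem
statement fails. [folklore] -/
theorem not_hexTransfer_iff :
    ¬ SAWDefectDecoherence.HexTransfer ↔ (HexSAWScalingLimit ∧ ¬ _root_.SAWScalingLimit) :=
  Classical.not_imp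

/-- A refutation of the crux refutes the summit conjunct `SAWScalingLimit`. [folklore] -/
theorem not_target_of_not_hexTransfer (h : ¬ SAWDefectDecoherence.HexTransfer) :
    ¬ _root_.SAWScalingLimit :=
  (not_hexTransfer_iff.1 h).2

/-- A refutation of the crux proves DCS Conjecture 1 (the open Literature statement). [folklore] -/
theorem hexSAWScalingLimit_of_not_hexTransfer (h : ¬ SAWDefectDecoherence.HexTransfer) :
    HexSAWScalingLimit :=
  (not_hexTransfer_iff.1 h).1

/-- The general shape: NO implication into the summit conjunct is refutable without refuting the summit
conjunct — applies verbatim to every "tail" crux `X → SAWScalingLimit` of the cone. [folklore] -/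
theorem not_target_of_not_imp_target {P : Prop} (h : ¬ (P → _root_.SAWScalingLimit)) :
    ¬ _root_.SAWScalingLimit :=
  fun hS => h fun _ => hS

/-- Under the antecedent the crux IS the summit conjunct (so it is then exactly as hard). [folklore] -/
theorem hexTransfer_iff_target_of_antecedent (hA : HexSAWScalingLimit) :
    SAWDefectDecoherence.HexTransfer ↔ _root_.SAWScalingLimit :=
  ⟨fun h => h hA, fun hS _ => hS⟩

/-- Existence debt inherited by any refutation: a chordal SLE(8/3) random curve in every Dobrushin domain
that carries a hexagonal endpoint approximation. [folklore] -/
theorem exists_isSLECurve_of_not_hexTransfer (h : ¬ SAWDefectDecoherence.HexTransfer)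
    {D : DobrushinDomain} {a b : ℝ → HexVertex} (hab : IsEmbEndpointApprox hexGraph hexCenter D a b) :
    ∃ Γ, IsSLECurve ((8 : ℝ≥0) / 3) D Γ := by
  obtain ⟨Γ, hΓ, -, -⟩ := hexSAWScalingLimit_of_not_hexTransfer h D a b hab
  exact ⟨Γ, hΓ⟩

/-- … unconditionally in the unit disc (`NonVacuity.isEmbEndpointApprox_unitDisc`). [folklore] -/
theorem exists_isSLECurve_unitDisc_of_not_hexTransfer (h : ¬ SAWDefectDecoherence.HexTransfer) :
    ∃ Γ, IsSLECurve ((8 : ℝ≥0) / 3) DobrushinDomain.unitDisc Γ :=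
  exists_isSLECurve_of_not_hexTransfer h HexConjecture.NonVacuity.isEmbEndpointApprox_unitDisc

/-! ## §3 Rigidity under the antecedent: `HexTransfer` forces lattice universality -/

/-- Two families converging in law (along the mesh filter) to random curves with the SAME law have
asymptotically equal integrals of every bounded continuous test function. [folklore] -/
theorem tendsto_sub_of_tendstoLaw {Ω₁ Ω₂ : ℝ → Type*} [∀ δ, MeasurableSpace (Ω₁ δ)]
    [∀ δ, MeasurableSpace (Ω₂ δ)] {Ω' : Type*} [MeasurableSpace Ω'] {X : Type*} [TopologicalSpace X]
    [MeasurableSpace X] [OpensMeasurableSpace X]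
    {Y₁ : ∀ δ, Ω₁ δ → X} {P₁ : ∀ δ, Measure (Ω₁ δ)} {Y₂ : ∀ δ, Ω₂ δ → X} {P₂ : ∀ δ, Measure (Ω₂ δ)}
    {Z₁ Z₂ : Ω' → X} {W : Measure Ω'} (h₁ : TendstoLaw Y₁ P₁ Z₁ W) (h₂ : TendstoLaw Y₂ P₂ Z₂ W)
    (hZ₁ : AEMeasurable Z₁ W) (hZ₂ : AEMeasurable Z₂ W) (hlaw : W.map Z₁ = W.map Z₂) (f : X →ᵇ ℝ) :
    Tendsto (fun δ => (∫ ω, f (Y₁ δ ω) ∂P₁ δ) - ∫ ω, f (Y₂ δ ω) ∂P₂ δ) (𝓝[>] (0 : ℝ)) (𝓝 0) := by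
  have hint : ∫ ω, f (Z₁ ω) ∂W = ∫ ω, f (Z₂ ω) ∂W := by
    rw [← integral_map hZ₁ f.continuous.aestronglyMeasurable,
      ← integral_map hZ₂ f.continuous.aestronglyMeasurable, hlaw]
  have h := (h₁ f).sub (h₂ f)
  rwa [hint, sub_self] at h

/-- **Rigidity.** If DCS Conjecture 1 holds, `HexTransfer` implies lattice universality of the critical
chordal SAW law for EVERY pairing of a δℤ² endpoint approximation with a hexagonal one (the two limits are
chordal SLE(8/3) random curves in the same Dobrushin domain, hence equal in law by
`IsSLECurve.map_eq_holds`). Stated negatively: modulo the antecedent, a failure of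
`LatticeUniversality` (stmt-0807) refutes the crux. [folklore] -/
theorem not_hexTransfer_of_not_latticeUniversality (hA : HexSAWScalingLimit)
    (hU : ¬ SAWResidueField.LatticeUniversality) : ¬ SAWDefectDecoherence.HexTransfer := by
  intro hTr
  apply hU
  intro D a b a' b' hab hab' f
  obtain ⟨Γ, hΓ, -, hT⟩ := hTr hA D a b hab
  obtain ⟨Γ', hΓ', -, hT'⟩ := hA D a' b' hab'
  exact tendsto_sub_of_tendstoLaw hT hT' hΓ.1 hΓ'.1 (IsSLECurve.map_eq_holds hΓ hΓ') f

/-- The same, as the equivalence it really is under the antecedent plus the (routine, open-as-item)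
existence of hexagonal endpoint approximations `HexEndpointApproxExists` (stmt-9864): then
`¬ HexTransfer ↔ ¬ LatticeUniversality`. The `←` direction is the two-ε argument. [folklore] -/
theorem not_hexTransfer_iff_not_latticeUniversality (hA : HexSAWScalingLimit)
    (hE : SAWResidueField.HexEndpointApproxExists) :
    ¬ SAWDefectDecoherence.HexTransfer ↔ ¬ SAWResidueField.LatticeUniversality := by
  refine ⟨fun h hU => h ?_, fun hU => not_hexTransfer_of_not_latticeUniversality hA hU⟩
  -- two-ε: LatticeUniversality + a hexagonal approximation + the antecedent give the δℤ² convergence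
  intro _ D a b hab
  obtain ⟨a', b', hab'⟩ := hE D a b hab
  obtain ⟨Γ, hΓ, -, hT⟩ := hA D a' b' hab'
  refine ⟨Γ, hΓ, Eventually.of_forall fun δ => aemeasurable_curve D.carrier δ (a δ) (b δ), fun f => ?_⟩
  have h := (hU D a b a' b' hab hab' f).add (hT f)
  rw [zero_add] at h
  exact h.congr fun δ => sub_add_cancel _ _

/-! ## §4 The line's open stub `stub_thetaTransport : HexConjecture → YBSquareSLE` -/

/-- Refuting the Θ-transport stub means proving DCS Conjecture 1 AND refuting `YBSquareSLE` (crux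
stmt-6967 of route SAWCompassLattice). [folklore] -/
theorem not_thetaTransport_iff :
    ¬ (SAWDevelopingMap.HexConjecture → SAWCompassLattice.YBSquareSLE) ↔
      (HexSAWScalingLimit ∧ ¬ SAWCompassLattice.YBSquareSLE) :=
  Classical.not_imp

/-- Under the antecedent the stub is `YBSquareSLE` itself. [folklore] -/
theorem thetaTransport_iff_of_antecedent (hA : HexSAWScalingLimit) :
    (SAWDevelopingMap.HexConjecture → SAWCompassLattice.YBSquareSLE) ↔ SAWCompassLattice.YBSquareSLE :=
  ⟨fun h => h hA, fun hY _ => hY⟩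

/-! ## §5 The two critical weights are different numbers -/

/-- `x_c(ℤ²) < x_c(ℍ)`: `x_c(ℤ²) = 1/μ(ℤ²) ≤ 1/2` (`2 ≤ μ(ℤ²)`, straight walks) while
`x_c(ℍ) = 1/√(2+√2) > 1/2` (`√(2+√2) < 2`). Hence the critical hexagonal weight `x_c(ℍ)^{ℓ(γ)}` and the
critical square weight `x_c(ℤ²)^{|γ|}` never agree on walks of equal positive length: no transfer between the
two critical laws is an identity of finite-volume Gibbs weights. [cite: MadrasSlade1993, §1.2, eq. (1.2.2)]
[cite: DuminilCopinSmirnov2012, Thm 1] -/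
theorem criticalFugacity_lt_hexCriticalFugacity : criticalFugacity < hexCriticalFugacity := by
  have h1 : criticalFugacity ≤ 1 / 2 := criticalFugacity_le_half
  have hs2 : Real.sqrt 2 < 2 := (Real.sqrt_lt' (by norm_num)).2 (by norm_num)
  have h2 : Real.sqrt (2 + Real.sqrt 2) < 2 := (Real.sqrt_lt' (by norm_num)).2 (by linarith)
  have h3 : (1 : ℝ) / 2 < hexCriticalFugacity := by
    rw [hexCriticalFugacity, one_div, inv_lt_inv₀ (by norm_num) (by positivity)]
    exact h2
  exact lt_of_le_of_lt h1 h3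

/-- In particular the two critical fugacities are distinct. [folklore] -/
theorem criticalFugacity_ne_hexCriticalFugacity : criticalFugacity ≠ hexCriticalFugacity :=
  criticalFugacity_lt_hexCriticalFugacity.ne

/-- … and the weights of walks of equal positive length differ. [folklore] -/
theorem criticalFugacity_pow_lt {n : ℕ} (hn : n ≠ 0) :
    criticalFugacity ^ n < hexCriticalFugacity ^ n :=
  pow_lt_pow_left₀ criticalFugacity_lt_hexCriticalFugacity criticalFugacity_pos_lt_one'.1.le hn

end Summit.CriticalPhenomena.SAWScalingLimit.Cruxes.HexTransfer.Negative
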